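import Literature.Probability.RandomPlanarGeometry.HexSAWBridgeDecay
import Literature.Probability.RandomPlanarGeometry.HexSAWEscapeMass
import Mathlib.Analysis.Convex.SpecificFunctions.Basic

/-!
# Crux `SAWDefectDecoherence.MassRatio` (stmt-CriticalPhenomena-8550), line `renewal-averaging-at-b` — the open stub `stub_renewalBlock` REDUCED to one bridge-shape fact

Line lead prover-line-stmt-CriticalPhenomena-8550-a1-0 (wave-1 worker file, landed by the lead as
`--supports stmt-CriticalPhenomena-8550`; registered sub-goal proved here: `renewalBlock_of_bridgeAveraged`).
A statement about ONE explicit real sequence `T ↦ HV.stripBlim T` (Duminil-Copin–Smirnov strip bridges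
at `x_c`); no line vocabulary needed. The stub itself stays OPEN (registered, sorried only in the
skeleton `Cruxes/MassRatio/Lines/renewal_averaging_at_b.lean`).

## The stub is EQUIVALENT (modulo the strip identity) to `RenewalBlock.BridgeAveraged HV.stripBlim`

The stub (dyadic block regularity `Σ_{s=t}^{2t} B_s ≥ p₀ Σ_{s=1}^{t} B_s` of `B_T = HV.stripBlim T`) is not
derivable from what the tree knows about `B_T` (`0 ≤ B_T ≤ 1 - c_α A_T ≤ 1`, `B_T → 0`
(`HV.tendsto_stripBlim`), the escape recursion `escape_le_succ`/`escape_ge`, and, under the strip identity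
`E_T ≡ 0`, `B_T ≥ m/T` and `1/B_{T+1} ≤ 1/B_T + C`): the harmonic profile `B_T = 1/(C T)` satisfies every
one of these constraints and violates the stub (`Σ_{[t,2t]} 1/s → log 2`, `Σ_{[1,t]} 1/s ∼ log t`).

This file records, sorry-free:
* `RenewalBlock.BlockRegular B` — the stub's conclusion as a predicate on a real sequence `B`;
* `RenewalBlock.BridgeAveraged B` — THE missing fact: `∃ C t₀, ∀ t ≥ t₀, Σ_{s=1}^{t} B_s ≤ C · t · B_t`
  (one-sided Karamata bound = lower Matuszewska index of `B` above `-1`; for `B_T ≍ T^{-α}` it holds iff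
  `α < 1`; prediction `α = 1/4`);
* `RenewalBlock.blockRegular_of_bridgeAveraged` — `B ≥ 0 ∧ BridgeAveraged B → BlockRegular B`
  (`p₀ = 1/(2 max(C,1))`): for `s ∈ [t,2t]`, `C s B_s ≥ Σ_{r ≤ s} B_r ≥ Σ_{r ≤ t} B_r`, sum over the
  `t+1` values of `s`;
* `RenewalBlock.bridgeAveraged_of_blockRegular` — the converse for nonnegative antitone `B` (`C = 2/p₀`);
* `RenewalBlock.bridgeAveraged_of_powerLaw` — `B_s ≤ C s^{-α}` (`s ≥ 1`), `c t^{-α} ≤ B_t` (`t ≥ t₀`),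
  `0 ≤ α < 1` give `BridgeAveraged B` (p-sum bound `sum_rpow_neg_le` by the Bernoulli step `bern_step`);
* `RenewalBlock.stripAlim_mono`, `RenewalBlock.stripBlim_antitone_of_stripIdentity` — `A_T` increases with
  `T` (`stripV_mono_T`), so under the strip identity `1 = c_α A_T + B_T` (BBDDG arXiv:1109.0358 Prop. 9;
  in the tree only under a refuted summability hypothesis, `stripElim_eq_zero`) `B_T` is antitone;
* `RenewalBlock.stub_of_bridgeAveraged : BridgeAveraged HV.stripBlim → (stub statement, verbatim)` and
  `RenewalBlock.bridgeAveraged_of_stub` (converse under the strip identity): modulo the cite-level strip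
  identity the stub is EQUIVALENT to `BridgeAveraged HV.stripBlim`, which is therefore the weakest
  bridge-shape fact that yields it.
Nearest printed results: DCS 2012 §3 (proof of Thm 1: `B_T ≥ min(B_1, x_c/c_α)/T` given `E_T = 0`),
Krachun–Panagiotis arXiv:2310.17299 Thm 2 (`B_T ≤ T^{-ε₀}`, not vendored), Beaton–Guttmann–Jensen
arXiv:1110.1141 (exact strips `T ≤ 10`, local exponent `≈ -1/4`). None gives a lower bound better than
`c/T` on dyadic blocks.
-/

noncomputable section

namespace Summit.CriticalPhenomena.SAWScalingLimit.Theorems.MassRatio.Renewal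

open Literature.Probability.LatticeModels Literature.Probability.RandomPlanarGeometry
open Literature.Probability.RandomPlanarGeometry.SAW

namespace RenewalBlock
/-! ### Helper lemmas for `stub_renewalBlock` (keep helpers inside this sub-namespace) -/

open Finset

/-- **Dyadic block regularity** of a real sequence `B` (the conclusion of `stub_renewalBlock` for
`B = HV.stripBlim`): `∃ p₀ > 0, t₀, ∀ t ≥ t₀, p₀ Σ_{s=1}^{t} B_s ≤ Σ_{s=t}^{2t} B_s`. [folklore] -/
def BlockRegular (B : ℕ → ℝ) : Prop :=
  ∃ p₀ : ℝ, 0 < p₀ ∧ ∃ t₀ : ℕ, ∀ t : ℕ, t₀ ≤ t →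
    p₀ * ∑ s ∈ Finset.Icc 1 t, B s ≤ ∑ s ∈ Finset.Icc t (2 * t), B s

/-- **The missing bridge-shape fact (one-sided Karamata bound / lower Matuszewska index `> -1`)** for a
real sequence `B`: `∃ C t₀, ∀ t ≥ t₀, Σ_{s=1}^{t} B_s ≤ C · t · B_t`. For `B = HV.stripBlim` (critical strip
bridges of the honeycomb lattice) this is OPEN: true for `B_T ≍ T^{-α}` iff `α < 1` (predicted `α = 1/4`),
false at the random-walk profile `B_T ≍ 1/T`. [folklore] -/
def BridgeAveraged (B : ℕ → ℝ) : Prop :=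
  ∃ C : ℝ, ∃ t₀ : ℕ, ∀ t : ℕ, t₀ ≤ t → ∑ s ∈ Finset.Icc 1 t, B s ≤ C * t * B t

/-- `#[t, 2t] = t + 1`. [folklore] -/
theorem card_Icc_two_mul (t : ℕ) : (Icc t (2 * t)).card = t + 1 := by
  rw [Nat.card_Icc]; omega

/-- **`BridgeAveraged ⇒ BlockRegular`** for nonnegative sequences, with `p₀ = 1/(2 max(C,1))`: for every
`s ∈ [t, 2t]`, `2 max(C,1) t B_s ≥ C s B_s ≥ Σ_{r ≤ s} B_r ≥ Σ_{r ≤ t} B_r`; sum over the `t + 1 ≥ t` values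
of `s`. [folklore] -/
theorem blockRegular_of_bridgeAveraged {B : ℕ → ℝ} (hB : ∀ s, 1 ≤ s → 0 ≤ B s)
    (h : BridgeAveraged B) : BlockRegular B := by
  obtain ⟨C, t₀, hC⟩ := h
  set C' := max C 1 with hC'
  have hC'1 : 1 ≤ C' := le_max_right _ _
  have hC'0 : 0 < C' := lt_of_lt_of_le one_pos hC'1
  refine ⟨(2 * C')⁻¹, by positivity, max t₀ 1, fun t ht => ?_⟩
  have ht₀ : t₀ ≤ t := le_trans (le_max_left _ _) ht
  have ht1 : 1 ≤ t := le_trans (le_max_right _ _) ht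
  have ht0 : (0 : ℝ) < t := by exact_mod_cast ht1
  set S := ∑ s ∈ Icc 1 t, B s with hS
  have hS0 : 0 ≤ S := sum_nonneg fun s hs => hB s (mem_Icc.1 hs).1
  have key : ∀ s ∈ Icc t (2 * t), S / (2 * C' * t) ≤ B s := by
    intro s hs
    rw [mem_Icc] at hs
    have h1 : ∑ r ∈ Icc 1 s, B r ≤ C * s * B s := hC s (ht₀.trans hs.1)
    have h2 : S ≤ ∑ r ∈ Icc 1 s, B r :=
      sum_le_sum_of_subset_of_nonneg (Icc_subset_Icc le_rfl hs.1)
        fun r hr _ => hB r (mem_Icc.1 hr).1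
    have hBs : 0 ≤ B s := hB s (ht1.trans hs.1)
    have hs2 : (s : ℝ) ≤ 2 * t := by exact_mod_cast hs.2
    have h3 : C * s * B s ≤ C' * (2 * t) * B s := by
      refine mul_le_mul_of_nonneg_right ?_ hBs
      calc C * s ≤ C' * s := mul_le_mul_of_nonneg_right (le_max_left _ _) (Nat.cast_nonneg _)
        _ ≤ C' * (2 * t) := mul_le_mul_of_nonneg_left hs2 hC'0.le
    rw [div_le_iff₀ (by positivity)]
    calc S ≤ C' * (2 * t) * B s := h2.trans (h1.trans h3)
      _ = B s * (2 * C' * t) := by ring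
  calc (2 * C')⁻¹ * S ≤ (t + 1 : ℝ) * (S / (2 * C' * t)) := by
        have e : (2 * C')⁻¹ * S = t * (S / (2 * C' * t)) := by
          field_simp
        rw [e]
        have : 0 ≤ S / (2 * C' * t) := by positivity
        nlinarith
    _ = ∑ _s ∈ Icc t (2 * t), S / (2 * C' * t) := by
        rw [sum_const, nsmul_eq_mul, card_Icc_two_mul]; push_cast; ring
    _ ≤ ∑ s ∈ Icc t (2 * t), B s := sum_le_sum key

/-- **`BlockRegular ⇒ BridgeAveraged`** for nonnegative sequences that are antitone on `[1, ∞)`, with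
`C = 2/p₀`: `p₀ Σ_{s ≤ t} B_s ≤ Σ_{s=t}^{2t} B_s ≤ (t+1) B_t ≤ 2 t B_t`. [folklore] -/
theorem bridgeAveraged_of_blockRegular {B : ℕ → ℝ} (hB : ∀ s, 1 ≤ s → 0 ≤ B s)
    (hmono : ∀ s t, 1 ≤ s → s ≤ t → B t ≤ B s) (h : BlockRegular B) : BridgeAveraged B := by
  obtain ⟨p₀, hp₀, t₀, hp⟩ := h
  refine ⟨2 / p₀, max t₀ 1, fun t ht => ?_⟩
  have ht₀ : t₀ ≤ t := le_trans (le_max_left _ _) ht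
  have ht1 : 1 ≤ t := le_trans (le_max_right _ _) ht
  have ht1' : (1 : ℝ) ≤ t := by exact_mod_cast ht1
  have h1 := hp t ht₀
  have h2 : ∑ s ∈ Icc t (2 * t), B s ≤ ∑ _s ∈ Icc t (2 * t), B t :=
    sum_le_sum fun s hs => hmono t s ht1 (mem_Icc.1 hs).1
  rw [sum_const, nsmul_eq_mul, card_Icc_two_mul] at h2
  push_cast at h2
  have hBt : 0 ≤ B t := hB t ht1
  have h3 : (t + 1 : ℝ) * B t ≤ 2 * t * B t := by nlinarith
  have h4 : p₀ * ∑ s ∈ Icc 1 t, B s ≤ 2 * t * B t := h1.trans (h2.trans h3)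
  rw [div_mul_eq_mul_div, div_mul_eq_mul_div, le_div_iff₀ hp₀]
  linarith

/-! ### Power laws: `c t^{-α} ≤ B_t ≤ C t^{-α}` with `α < 1` gives `BridgeAveraged` -/

/-- The Bernoulli step `M t^{1-κ} + K (t+1)^{-κ} ≤ M (t+1)^{1-κ}` for `t ≥ 1`, `0 ≤ κ ≤ 1`,
`K ≤ M (1-κ)`. [folklore] -/
-- adapted from Summits/CriticalPhenomena/SAWScalingLimit/Cruxes/MassRatio/PinchedDoubleBridgeGainModule.lean (`bern_step`)
theorem bern_step {M K κ t : ℝ} (hM : 0 ≤ M) (hκ0 : 0 ≤ κ) (hκ1 : κ ≤ 1)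
    (hKM : K ≤ M * (1 - κ)) (ht : 1 ≤ t) :
    M * t ^ (1 - κ) + K * (t + 1) ^ (-κ) ≤ M * (t + 1) ^ (1 - κ) := by
  have ht0 : 0 < t := by linarith
  have hu0 : 0 < t + 1 := by linarith
  have hb : (1 + t⁻¹) ^ κ ≤ 1 + κ * t⁻¹ :=
    rpow_one_add_le_one_add_mul_self (by have := inv_nonneg.2 ht0.le; linarith) hκ0 hκ1
  have hsplit : (t + 1) ^ κ = t ^ κ * (1 + t⁻¹) ^ κ := by
    rw [← Real.mul_rpow ht0.le (by positivity)]
    congr 1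
    field_simp
  have h1 : t ^ (1 - κ) * (t + 1) ^ κ ≤ t + κ := by
    rw [hsplit, ← mul_assoc, ← Real.rpow_add ht0, show (1 - κ) + κ = 1 by ring, Real.rpow_one]
    calc t * (1 + t⁻¹) ^ κ ≤ t * (1 + κ * t⁻¹) := mul_le_mul_of_nonneg_left hb ht0.le
      _ = t + κ := by field_simp
  have hQ : 0 ≤ (t + 1) ^ (-κ) := Real.rpow_nonneg hu0.le _
  have hPQ : (t + 1) ^ κ * (t + 1) ^ (-κ) = 1 := by
    rw [← Real.rpow_add hu0, add_neg_cancel, Real.rpow_zero]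
  have e1 : (t + 1) ^ (1 - κ) = (t + 1) * (t + 1) ^ (-κ) := by
    rw [sub_eq_add_neg, Real.rpow_add hu0, Real.rpow_one]
  have e2 : M * t ^ (1 - κ) + K * (t + 1) ^ (-κ) =
      (M * (t ^ (1 - κ) * (t + 1) ^ κ) + K) * (t + 1) ^ (-κ) := by
    rw [add_mul, mul_assoc M, mul_assoc (t ^ (1 - κ)), hPQ, mul_one]
  rw [e2, e1, show M * ((t + 1) * (t + 1) ^ (-κ)) = (M * (t + 1)) * (t + 1) ^ (-κ) from
    (mul_assoc _ _ _).symm]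
  refine mul_le_mul_of_nonneg_right ?_ hQ
  have h2 : M * (t ^ (1 - κ) * (t + 1) ^ κ) ≤ M * (t + κ) := mul_le_mul_of_nonneg_left h1 hM
  nlinarith [h2, hKM]

/-- The `p`-sum bound `Σ_{s=1}^{t} s^{-α} ≤ t^{1-α}/(1-α)` for `0 ≤ α < 1`, `t ≥ 1` (induction with the
Bernoulli step). [folklore] -/
theorem sum_rpow_neg_le {α : ℝ} (hα0 : 0 ≤ α) (hα1 : α < 1) {t : ℕ} (ht : 1 ≤ t) :
    ∑ s ∈ Icc 1 t, (s : ℝ) ^ (-α) ≤ (1 - α)⁻¹ * (t : ℝ) ^ (1 - α) := by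
  have hM : 0 ≤ (1 - α)⁻¹ := inv_nonneg.2 (by linarith)
  induction t, ht using Nat.le_induction with
  | base =>
    simp only [Icc_self, sum_singleton, Nat.cast_one, Real.one_rpow, mul_one]
    rw [le_inv_comm₀ one_pos (by linarith), inv_one]
    linarith
  | succ t ht ih =>
    rw [Finset.sum_Icc_succ_top (by omega), Nat.cast_succ]
    have ht1 : (1 : ℝ) ≤ t := by exact_mod_cast ht
    have hstep := bern_step (M := (1 - α)⁻¹) (K := 1) (κ := α) (t := (t : ℝ)) hM hα0 hα1.le
      (by rw [inv_mul_cancel₀ (by linarith)]) ht1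
    linarith

/-- **Two-sided power laws give the missing fact**: if `B_s ≤ C s^{-α}` for `s ≥ 1` and
`c t^{-α} ≤ B_t` for `t ≥ t₀`, with `0 ≤ α < 1`, `c > 0`, then `BridgeAveraged B` (constant
`C / ((1-α) c)`). In particular the prediction `B_T ≍ T^{-1/4}` implies the stub. [folklore] -/
theorem bridgeAveraged_of_powerLaw {B : ℕ → ℝ} {α c C : ℝ} {t₀ : ℕ} (hα0 : 0 ≤ α) (hα1 : α < 1)
    (hc : 0 < c) (hC : 0 ≤ C) (hup : ∀ s : ℕ, 1 ≤ s → B s ≤ C * (s : ℝ) ^ (-α))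
    (hlow : ∀ t : ℕ, t₀ ≤ t → c * (t : ℝ) ^ (-α) ≤ B t) : BridgeAveraged B := by
  refine ⟨C / ((1 - α) * c), max t₀ 1, fun t ht => ?_⟩
  have ht₀ : t₀ ≤ t := le_trans (le_max_left _ _) ht
  have ht1 : 1 ≤ t := le_trans (le_max_right _ _) ht
  have ht0 : (0 : ℝ) < t := by exact_mod_cast ht1
  have h1α : 0 < 1 - α := by linarith
  have h1 : ∑ s ∈ Icc 1 t, B s ≤ C * ((1 - α)⁻¹ * (t : ℝ) ^ (1 - α)) := by
    calc ∑ s ∈ Icc 1 t, B s ≤ ∑ s ∈ Icc 1 t, C * (s : ℝ) ^ (-α) :=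
          sum_le_sum fun s hs => hup s (mem_Icc.1 hs).1
      _ = C * ∑ s ∈ Icc 1 t, (s : ℝ) ^ (-α) := by rw [mul_sum]
      _ ≤ C * ((1 - α)⁻¹ * (t : ℝ) ^ (1 - α)) :=
          mul_le_mul_of_nonneg_left (sum_rpow_neg_le hα0 hα1 ht1) hC
  have h2 : (t : ℝ) ^ (1 - α) = t * (t : ℝ) ^ (-α) := by
    rw [sub_eq_add_neg, Real.rpow_add ht0, Real.rpow_one]
  have h3 := hlow t ht₀
  have hpow : 0 ≤ (t : ℝ) ^ (-α) := Real.rpow_nonneg ht0.le _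
  calc ∑ s ∈ Icc 1 t, B s ≤ C * ((1 - α)⁻¹ * (t : ℝ) ^ (1 - α)) := h1
    _ = C / ((1 - α) * c) * t * (c * (t : ℝ) ^ (-α)) := by
        rw [h2]; field_simp
    _ ≤ C / ((1 - α) * c) * t * B t :=
        mul_le_mul_of_nonneg_left h3 (by positivity)

/-! ### The explicit sequence `B_T = HV.stripBlim T` -/

/-- `A_{T,L}(x_c)` is monotone in `T` (`S_{T,L} ⊆ S_{T',L}` and the `α`-darts do not depend on `T`).
[folklore] -/
theorem stripA_mono_T {T T' L : ℕ} (h : T ≤ T') :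
    HV.stripA T L hexCriticalFugacity ≤ HV.stripA T' L hexCriticalFugacity :=
  sum_le_sum_of_subset_of_nonneg
    (filter_subset_filter _ (HV.midWalks_mono (HV.stripV_mono_T h)))
    fun _ _ _ => pow_nonneg hexCriticalFugacity_pos_lt_one.1.le _

/-- `A_T ≤ A_{T'}` for `1 ≤ T ≤ T'` (pass to `sup_L`). [folklore] -/
theorem stripAlim_mono {T T' : ℕ} (hT : 1 ≤ T) (h : T ≤ T') : HV.stripAlim T ≤ HV.stripAlim T' :=
  ciSup_le fun L =>
    (stripA_mono_T h).trans (stripA_le_lim DuminilCopinSmirnov2012_lemma2_holds (hT.trans h) L)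

/-- The escape mass `G_T = 1 - c_α A_T` is antitone in `T ≥ 1`. [folklore] -/
theorem escape_antitone {T T' : ℕ} (hT : 1 ≤ T) (h : T ≤ T') :
    1 - Real.cos (3 * Real.pi / 8) * HV.stripAlim T' ≤ 1 - Real.cos (3 * Real.pi / 8) * HV.stripAlim T := by
  have := mul_le_mul_of_nonneg_left (stripAlim_mono hT h) cos_three_pi_div_eight_pos.le
  linarith

/-- Under the strip identity `1 = c_α A_T + B_T` (`T ≥ 1`; BBDDG arXiv:1109.0358 Prop. 9, i.e. `E_T ≡ 0`),
`B_T = G_T` is antitone on `T ≥ 1`. [folklore] -/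
theorem stripBlim_antitone_of_stripIdentity
    (hid : ∀ T : ℕ, 1 ≤ T → (1 : ℝ) = Real.cos (3 * Real.pi / 8) * HV.stripAlim T + HV.stripBlim T)
    (s t : ℕ) (hs : 1 ≤ s) (hst : s ≤ t) : HV.stripBlim t ≤ HV.stripBlim s := by
  have h1 := hid s hs
  have h2 := hid t (hs.trans hst)
  have h3 := escape_antitone hs hst
  linarith

/-- **Reduction of the stub to the missing fact**: `BridgeAveraged HV.stripBlim` implies the statement of
`stub_renewalBlock` verbatim (only `B_T ≥ 0`, `stripBlim_nonneg`, is used). [folklore] -/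
theorem stub_of_bridgeAveraged (h : BridgeAveraged HV.stripBlim) :
    ∃ p₀ : ℝ, 0 < p₀ ∧ ∃ t₀ : ℕ, ∀ t : ℕ, t₀ ≤ t →
      p₀ * ∑ s ∈ Finset.Icc 1 t, HV.stripBlim s ≤ ∑ s ∈ Finset.Icc t (2 * t), HV.stripBlim s :=
  blockRegular_of_bridgeAveraged (fun _ hs => stripBlim_nonneg hs) h

/-- **Converse under the strip identity**: if `1 = c_α A_T + B_T` for all `T ≥ 1`, the statement of
`stub_renewalBlock` implies `BridgeAveraged HV.stripBlim`; so, modulo that cite-level identity, the stub is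
equivalent to `BridgeAveraged HV.stripBlim`. [folklore] -/
theorem bridgeAveraged_of_stub
    (hid : ∀ T : ℕ, 1 ≤ T → (1 : ℝ) = Real.cos (3 * Real.pi / 8) * HV.stripAlim T + HV.stripBlim T)
    (h : ∃ p₀ : ℝ, 0 < p₀ ∧ ∃ t₀ : ℕ, ∀ t : ℕ, t₀ ≤ t →
      p₀ * ∑ s ∈ Finset.Icc 1 t, HV.stripBlim s ≤ ∑ s ∈ Finset.Icc t (2 * t), HV.stripBlim s) :
    BridgeAveraged HV.stripBlim :=
  bridgeAveraged_of_blockRegular (fun _ hs => stripBlim_nonneg hs)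
    (stripBlim_antitone_of_stripIdentity hid) h

end RenewalBlock

/-- **Registered sub-goal (crux item stmt-CriticalPhenomena-8550): the open stub `stub_renewalBlock`
follows from the one-sided Karamata bound `RenewalBlock.BridgeAveraged HV.stripBlim`** — dyadic block
regularity of the DCS bridge sequence from `Σ_{s≤t} B_s ≤ C t B_t` (`p₀ = 1/(2 max(C,1))`, only
`B_T ≥ 0` used). [folklore] -/
theorem renewalBlock_of_bridgeAveraged :
    RenewalBlock.BridgeAveraged HV.stripBlim →
      ∃ p₀ : ℝ, 0 < p₀ ∧ ∃ t₀ : ℕ, ∀ t : ℕ, t₀ ≤ t →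
        p₀ * ∑ s ∈ Finset.Icc 1 t, HV.stripBlim s ≤ ∑ s ∈ Finset.Icc t (2 * t), HV.stripBlim s :=
  RenewalBlock.stub_of_bridgeAveraged

end Summit.CriticalPhenomena.SAWScalingLimit.Theorems.MassRatio.Renewal
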